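import Literature.NumberTheory.EllipticCurves.Sprung2017.HalfLogarithmMatrixInvolutionModThreeProofs
import HarnessLib

/-!
# Sprung 2017, §3.4 (Prop. 3.14) at `(p, a_p) = (3, 3b)`, MOD `3T²`: the off-diagonal entry `M₀₁` of the integral
# transition matrix `M` of `ℒ(T) = M(T)·ℒ(T^ι)` is `3·T·(unit)` when `3 ∤ b` — proofs only

A *proofs* companion (theorems only; no definition, no named fact) of `HalfLogarithmMatrixInvolutionProofs`
(`ℒ = M·ℒ(T^ι)`, `M ∈ M₂(ℤ_3⟦T⟧)`; `ℒ = halfLogMatrix b`, `ι = (1+T)⁻¹ − 1`) and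
`HalfLogarithmMatrixInvolutionModThreeProofs` (`M` diagonal mod `3`, diagonal `≡ 1` mod `T`).

## What is proved

The twist factors `E_{n+1} = 1 + T·g·x_n·(−v_{n+1}, u_{n+1})`, `g = (1+T)^{3^n} + 1`, are `≡ 1 (mod T)` in ALL FOUR
entries, and the `T¹`-coefficient of `(E_{n+1})₀₁ = T·g·u_n·u_{n+1}` is `g(0)·u_n(0)·u_{n+1}(0) = 2·u_n(0)·u_{n+1}(0)`.
Since `Φ_{3^{m+1}}(1) = 3`, the constant terms `w_m = u_m(0)` obey `w_{m+2} = 3b·w_{m+1} − 3·w_m`, so `3 ∣ w_m` for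
`m ≥ 2` and `9 ∣ w_m w_{m+1}` for `m ≥ 2`; with `w_0 w_1 + w_1 w_2 = 0·1 + 1·3b` this gives, for every `n ≥ 2`,
`[T¹](M_n)₀₁ = 2·Σ_{m<n} w_m w_{m+1} ≡ 6b (mod 9)`. Carrying these invariants through the induction
`M_{n+1} = E_{n+1}M_n` and the compactness limit of `HalfLogarithmMatrixInvolutionProofs`:

* §1 `coeff_zero_sharpPoly_add_two`, `nine_dvd_two_mul_sum_sub` — the constant-term recursion and the congruence;
* §2 `exists_twistMatrix_rowSeq_offDiag` — the integer twist matrices `M_n` can be taken with `3 ∣ (M_n)₀₁, (M_n)₁₀`,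
  `M_n ≡ 1 (mod T)` (all four entries) and `[T¹](M_n)₀₁ = 2·Σ_{m<n} u_m(0)u_{m+1}(0)`;
* §3 `exists_twistMatrix_halfLogApprox_offDiag` — the same for the approximants `A_n = M_n·A_n(T^ι)`;
* §4 **`exists_integral_halfLogMatrix_eq_mul_subst_offDiag`** — there is `M ∈ M₂(ℤ_3⟦T⟧)` with `ℒ = M·ℒ(T^ι)`,
  `3 ∣ M₀₁, M₁₀` coefficientwise, `M ≡ 1 (mod T)`, and `9 ∣ [T¹]M₀₁ − 6b`;
* §5 **`exists_integral_halfLogMatrix_offDiag_eq_C_mul_X_mul_unit`** — for `3 ∤ b` (e.g. `a_3 = ±3`):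
  `M₀₁ = C(3)·T·u` with `u ∈ Λˣ`.

CONSUMER (Summits side, crux `SprungLowerDivisibilityAtThree`, line `chromatic-common-zeros`): with the PROVED
trace-coordinate functional equation this gives `3T·u·L♯ = κ′·L♭(T^ι) − M₁₁·L♭` for every X8 Sprung pair — the
pair `(L♯, L♭)` is determined by `L♭` alone, and the common zeros of the two colours off `{T = 0} ∪ {3 = 0}` are
exactly the `ι`-PAIRED zeros of ONE colour. HONEST FRAMING: elementary algebra about the tree's own definitions;
special case `p = 3`; nothing about any curve; BSD is not proved by any of this.

References: [Sprung2017] §3.1, §3.4 Prop. 3.14, Cor. 4.4, Cor. 4.6; [GreenbergLNM1716] §1.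
-/

noncomputable section

open scoped MatrixGroups

open Polynomial Filter Topology Literature.Barriers.BirchSwinnertonDyer

namespace Literature.NumberTheory.EllipticCurves.Sprung2017

/-! ## §1 Constant terms of `u_n` at `a = 3b` -/

section ConstantTerms

/-- `Φ_{3^{n+1}}(1+T)` has constant term `Φ_{3^{n+1}}(1) = 3`. [cite: Sprung2017, §3.1 (𝒞_i(ζ) = C at ζ = 1)] -/
theorem coeff_zero_cyclotomic_three_pow_succ_comp (n : ℕ) :
    ((cyclotomic (3 ^ (n + 1)) ℤ).comp (X + 1)).coeff 0 = 3 := by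
  rw [cyclotomic_three_pow_succ_comp, coeff_add, coeff_add, coeff_X_add_one_pow, coeff_X_add_one_pow,
    coeff_one_zero]
  simp

/-- `g = (T+1)^{3^n} + 1` has constant term `2` (private plumbing). [folklore] -/
private theorem coeff_zero_X_add_one_pow_add_one (n : ℕ) :
    (((X + 1) ^ 3 ^ n + 1 : ℤ[X])).coeff 0 = 2 := by
  rw [coeff_add, coeff_X_add_one_pow, coeff_one_zero]
  simp

/-- The constant-term recursion `u_{n+2}(0) = 3·(b·u_{n+1}(0) − u_n(0))` at `a = 3b`
(`Φ_{3^{n+1}}(1) = 3`). [cite: Sprung2017, Cor. 4.4] -/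
theorem coeff_zero_sharpPoly_add_two (b : ℤ) (n : ℕ) :
    (sharpPoly (3 * b) 3 (n + 2)).coeff 0 =
      3 * (b * (sharpPoly (3 * b) 3 (n + 1)).coeff 0 - (sharpPoly (3 * b) 3 n).coeff 0) := by
  rw [sharpPoly_add_two, coeff_sub, coeff_C_mul, mul_coeff_zero, coeff_zero_cyclotomic_three_pow_succ_comp]
  ring

/-- `3 ∣ u_{n+2}(0)` at `a = 3b`. [cite: Sprung2017, Cor. 4.4] -/
theorem three_dvd_coeff_zero_sharpPoly_add_two (b : ℤ) (n : ℕ) :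
    (3 : ℤ) ∣ (sharpPoly (3 * b) 3 (n + 2)).coeff 0 := by
  rw [coeff_zero_sharpPoly_add_two]
  exact dvd_mul_right 3 _

/-- **The `T¹`-congruence**: for `n ≥ 2`, `2·Σ_{m<n} u_m(0)u_{m+1}(0) ≡ 6b (mod 9)` (`u_0 = 0`, `u_1 = 1`,
`u_2 = 3b`, and `9 ∣ u_m(0)u_{m+1}(0)` for `m ≥ 2`). [cite: Sprung2017, Cor. 4.4] -/
theorem nine_dvd_two_mul_sum_sub (b : ℤ) (n : ℕ) (hn : 2 ≤ n) :
    (9 : ℤ) ∣ 2 * (∑ m ∈ Finset.range n,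
        (sharpPoly (3 * b) 3 m).coeff 0 * (sharpPoly (3 * b) 3 (m + 1)).coeff 0) - 6 * b := by
  induction n, hn using Nat.le_induction with
  | base =>
    have h2 : (sharpPoly (3 * b) 3 2).coeff 0 = 3 * b := by
      rw [sharpPoly_two, coeff_C_zero]
    simp only [Finset.sum_range_succ, Finset.sum_range_zero, sharpPoly_zero, sharpPoly_one, coeff_zero,
      coeff_one_zero, h2]
    exact ⟨0, by ring⟩
  | succ n hn ih =>
    rw [Finset.sum_range_succ, mul_add, add_sub_right_comm]
    refine dvd_add ih ?_
    obtain ⟨m, rfl⟩ : ∃ m, n = m + 2 := ⟨n - 2, by omega⟩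
    obtain ⟨x, hx⟩ := three_dvd_coeff_zero_sharpPoly_add_two b m
    obtain ⟨y, hy⟩ := three_dvd_coeff_zero_sharpPoly_add_two b (m + 1)
    rw [show m + 2 + 1 = m + 1 + 2 from by ring, hx, hy]
    exact ⟨2 * x * y, by ring⟩

end ConstantTerms

/-! ## §2 Twist matrices with the mod-3 / mod-T / `T¹` invariants -/

section Twist

/-- `(p·q).coeff 1 = p(0)·q₁ + p₁·q(0)` (private plumbing). [folklore] -/
private theorem coeff_one_mul (p q : ℤ[X]) :
    (p * q).coeff 1 = p.coeff 0 * q.coeff 1 + p.coeff 1 * q.coeff 0 := by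
  rw [coeff_mul, show (1 : ℕ) = 0 + 1 from rfl, Finset.Nat.antidiagonal_succ, Finset.sum_cons,
    Finset.Nat.antidiagonal_zero]
  simp

variable {S : Type*} [CommRing S] (ψ : ℤ[X] →+* S) (σ : S →+* S) (b : ℤ)

/-- **The twist matrices, refined mod `3`, mod `T` and at `T¹`.** As `exists_twistMatrix_rowSeq` at `a = 3b`,
with the invariants `3 ∣ M_{01}`, `3 ∣ M_{10}`, `M_{00}(0) = M_{11}(0) = 1`, `M_{01}(0) = M_{10}(0) = 0` and
`[T¹]M_{01} = 2·Σ_{m<n} u_m(0)u_{m+1}(0)` (the factors `E_{m+1}` are `≡ 1` mod `T` and `[T¹](E_{m+1})₀₁ =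
g(0)u_m(0)u_{m+1}(0)`, `g(0) = 2`). [cite: Sprung2017, §3.4 Prop. 3.14 and Cor. 4.4] -/
theorem exists_twistMatrix_rowSeq_offDiag (hC : σ (ψ (C (3 * b))) = ψ (C (3 * b)))
    (hΦ : ∀ m : ℕ, ∃ w : S, σ (ψ ((cyclotomic (3 ^ (m + 1)) ℤ).comp (X + 1))) =
        w * ψ ((cyclotomic (3 ^ (m + 1)) ℤ).comp (X + 1)) ∧ ψ ((X + 1) ^ (2 * 3 ^ m)) * w = 1)
    (n : ℕ) :
    ∃ M : Matrix (Fin 2) (Fin 2) ℤ[X], ((C 3 : ℤ[X]) ∣ M 0 1 ∧ (C 3 : ℤ[X]) ∣ M 1 0 ∧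
        (M 0 0).coeff 0 = 1 ∧ (M 1 1).coeff 0 = 1 ∧ (M 0 1).coeff 0 = 0 ∧ (M 1 0).coeff 0 = 0 ∧
        (M 0 1).coeff 1 = 2 * ∑ m ∈ Finset.range n,
          (sharpPoly (3 * b) 3 m).coeff 0 * (sharpPoly (3 * b) 3 (m + 1)).coeff 0) ∧
      ∀ m : ℕ, (m = n + 1 ∨ m = n) → ∀ i : Fin 2,
        ψ (rowSeq (3 * b) 3 i m) =
          ψ (M i 0) * σ (ψ (rowSeq (3 * b) 3 0 m)) + ψ (M i 1) * σ (ψ (rowSeq (3 * b) 3 1 m)) := by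
  induction n with
  | zero =>
    refine ⟨1, ⟨by simp, by simp, by simp, by simp, by simp, by simp, by simp⟩, fun m hm i => ?_⟩
    rcases hm with rfl | rfl <;> fin_cases i <;> simp [rowSeq, Matrix.one_apply]
  | succ n ih =>
    obtain ⟨M, ⟨hM01, hM10, hM00, hM11, hM01z, hM10z, hM01o⟩, hM⟩ := ih
    set a : ℤ := 3 * b with ha
    -- the factor `E_{n+1}`, `g = (1+T)^{3^n} + 1`
    set E : Matrix (Fin 2) (Fin 2) ℤ[X] :=
      !![1 - X * ((X + 1) ^ 3 ^ n + 1) * sharpPoly a 3 n * flatPoly a 3 (n + 1),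
          X * ((X + 1) ^ 3 ^ n + 1) * sharpPoly a 3 n * sharpPoly a 3 (n + 1);
        -(X * ((X + 1) ^ 3 ^ n + 1) * flatPoly a 3 n * flatPoly a 3 (n + 1)),
          1 + X * ((X + 1) ^ 3 ^ n + 1) * flatPoly a 3 n * sharpPoly a 3 (n + 1)] with hEdef
    have hE00 : E 0 0 = 1 - X * ((X + 1) ^ 3 ^ n + 1) * sharpPoly a 3 n * flatPoly a 3 (n + 1) := rfl
    have hE01 : E 0 1 = X * ((X + 1) ^ 3 ^ n + 1) * sharpPoly a 3 n * sharpPoly a 3 (n + 1) := rfl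
    have hE10 : E 1 0 = -(X * ((X + 1) ^ 3 ^ n + 1) * flatPoly a 3 n * flatPoly a 3 (n + 1)) := rfl
    have hE11 : E 1 1 = 1 + X * ((X + 1) ^ 3 ^ n + 1) * flatPoly a 3 n * sharpPoly a 3 (n + 1) := rfl
    have hdet := X_mul_det_rowSeq a n
    -- `E` fixes the column `x_{n+1}` …
    have hP1 : ∀ i : Fin 2, E i 0 * sharpPoly a 3 (n + 1) + E i 1 * flatPoly a 3 (n + 1) = rowSeq a 3 i (n + 1) := by
      intro i
      fin_cases i
      · simp only [Fin.zero_eta, Fin.isValue, hE00, hE01, rowSeq_zero]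
        ring
      · simp only [Fin.mk_one, Fin.isValue, hE10, hE11, rowSeq_one]
        ring
    -- … and multiplies the column `x_n` by `(1+T)^{2·3^n}`
    have hP2 : ∀ i : Fin 2, E i 0 * sharpPoly a 3 n + E i 1 * flatPoly a 3 n =
        (X + 1) ^ (2 * 3 ^ n) * rowSeq a 3 i n := by
      intro i
      fin_cases i
      · simp only [Fin.zero_eta, Fin.isValue, hE00, hE01, rowSeq_zero]
        linear_combination (((X + 1) ^ 3 ^ n + 1) * sharpPoly a 3 n) * hdet
      · simp only [Fin.mk_one, Fin.isValue, hE10, hE11, rowSeq_one]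
        linear_combination (((X + 1) ^ 3 ^ n + 1) * flatPoly a 3 n) * hdet
    -- the identities of the induction hypothesis, both old columns, read on `u` and `v`
    have hU1 := hM (n + 1) (Or.inl rfl) 0
    have hV1 := hM (n + 1) (Or.inl rfl) 1
    have hU0 := hM n (Or.inr rfl) 0
    have hV0 := hM n (Or.inr rfl) 1
    simp only [rowSeq_zero, rowSeq_one] at hU1 hV1 hU0 hV0
    have hEM' : ∀ i l : Fin 2, (E * M) i l = E i 0 * M 0 l + E i 1 * M 1 l := fun i l => by
      rw [Matrix.mul_apply, Fin.sum_univ_two]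
    have hE01dvd : (C 3 : ℤ[X]) ∣ E 0 1 := by
      rw [hE01, mul_assoc]
      exact Dvd.dvd.mul_left (three_dvd_sharpPoly_mul_succ b n) _
    have hE10dvd : (C 3 : ℤ[X]) ∣ E 1 0 := by
      rw [hE10, mul_assoc]
      exact (Dvd.dvd.mul_left (three_dvd_flatPoly_mul_succ b n) _).neg_right
    -- the constant and linear coefficients of the entries of `E`
    have hE00z : (E 0 0).coeff 0 = 1 := by
      rw [hE00]
      simp
    have hE11z : (E 1 1).coeff 0 = 1 := by
      rw [hE11]
      simp
    have hE01z : (E 0 1).coeff 0 = 0 := by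
      rw [hE01]
      simp
    have hE10z : (E 1 0).coeff 0 = 0 := by
      rw [hE10]
      simp
    have hE01o : (E 0 1).coeff 1 = 2 * ((sharpPoly a 3 n).coeff 0 * (sharpPoly a 3 (n + 1)).coeff 0) := by
      rw [hE01, mul_assoc, mul_assoc, coeff_X_mul, mul_coeff_zero, mul_coeff_zero,
        coeff_zero_X_add_one_pow_add_one]
    have hinv : (C 3 : ℤ[X]) ∣ (E * M) 0 1 ∧ (C 3 : ℤ[X]) ∣ (E * M) 1 0 ∧
        ((E * M) 0 0).coeff 0 = 1 ∧ ((E * M) 1 1).coeff 0 = 1 ∧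
        ((E * M) 0 1).coeff 0 = 0 ∧ ((E * M) 1 0).coeff 0 = 0 ∧
        ((E * M) 0 1).coeff 1 = 2 * ∑ m ∈ Finset.range (n + 1),
          (sharpPoly (3 * b) 3 m).coeff 0 * (sharpPoly (3 * b) 3 (m + 1)).coeff 0 := by
      refine ⟨?_, ?_, ?_, ?_, ?_, ?_, ?_⟩
      · rw [hEM']
        exact dvd_add (Dvd.dvd.mul_left hM01 _) (Dvd.dvd.mul_right hE01dvd _)
      · rw [hEM']
        exact dvd_add (Dvd.dvd.mul_right hE10dvd _) (Dvd.dvd.mul_left hM10 _)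
      · rw [hEM', coeff_add, mul_coeff_zero, mul_coeff_zero, hM00, hE00z, hE01z]
        ring
      · rw [hEM', coeff_add, mul_coeff_zero, mul_coeff_zero, hM11, hE10z, hE11z]
        ring
      · rw [hEM', coeff_add, mul_coeff_zero, mul_coeff_zero, hE00z, hM01z, hE01z, hM11]
        ring
      · rw [hEM', coeff_add, mul_coeff_zero, mul_coeff_zero, hE10z, hM00, hE11z, hM10z]
        ring
      · rw [hEM', coeff_add, coeff_one_mul, coeff_one_mul, hE00z, hM01z, hE01z, hM11, hE01o, hM01o,
          Finset.sum_range_succ, ← ha]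
        ring
    refine ⟨E * M, hinv, fun m hm i => ?_⟩
    have hEM : ∀ l : Fin 2, (E * M) i l = E i 0 * M 0 l + E i 1 * M 1 l := fun l => by
      rw [Matrix.mul_apply, Fin.sum_univ_two]
    have hP1i := congrArg ψ (hP1 i)
    have hP2i := congrArg ψ (hP2 i)
    simp only [map_add, map_mul] at hP1i hP2i
    rw [rowSeq_zero, rowSeq_one, hEM 0, hEM 1]
    simp only [map_add, map_mul]
    rcases hm with rfl | rfl
    · -- the NEW column `x_{n+2} = a·x_{n+1} − Φ·x_n`
      obtain ⟨w, hw, hw1⟩ := hΦ n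
      have hrow : rowSeq a 3 i (n + 1 + 1) =
          C a * rowSeq a 3 i (n + 1) - (cyclotomic (3 ^ (n + 1)) ℤ).comp (X + 1) * rowSeq a 3 i n := by
        fin_cases i
        · exact sharpPoly_add_two a 3 n
        · exact flatPoly_add_two a 3 n
      rw [hrow, sharpPoly_add_two, flatPoly_add_two]
      simp only [map_sub, map_mul, hC, hw]
      linear_combination (ψ (C a) * ψ (E i 0)) * hU1 + (ψ (C a) * ψ (E i 1)) * hV1 +
        (-(w * ψ ((cyclotomic (3 ^ (n + 1)) ℤ).comp (X + 1)) * ψ (E i 0))) * hU0 +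
        (-(w * ψ ((cyclotomic (3 ^ (n + 1)) ℤ).comp (X + 1)) * ψ (E i 1))) * hV0 +
        (-ψ (C a)) * hP1i + (w * ψ ((cyclotomic (3 ^ (n + 1)) ℤ).comp (X + 1))) * hP2i +
        (ψ ((cyclotomic (3 ^ (n + 1)) ℤ).comp (X + 1)) * ψ (rowSeq a 3 i n)) * hw1
    · -- the column `x_{n+1}` is fixed by `E`
      linear_combination ψ (E i 0) * hU1 + ψ (E i 1) * hV1 + (-1 : S) * hP1i

end Twist

/-! ## §3 The approximants with invariants -/

section Approximants

/-- An integer polynomial read in `ℚ_3⟦T⟧` through `Λ` is its image through `ℚ` (private plumbing). [folklore] -/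
private theorem coe_map_map_eq'' (q : ℤ[X]) :
    (((q.map (Int.castRingHom ℚ)).map (algebraMap ℚ ℚ_[3]) : ℚ_[3][X]) : PowerSeries ℚ_[3]) =
      (iwasawaToPowerSeries 3).comp (toIwasawa 3) q := by
  rw [RingHom.comp_apply]
  change _ = PowerSeries.map (algebraMap ℤ_[3] ℚ_[3])
    (((q.map (Int.castRingHom ℤ_[3])) : ℤ_[3][X]) : PowerSeries ℤ_[3])
  rw [← Polynomial.polynomial_map_coe, Polynomial.map_map, Polynomial.map_map,
    RingHom.ext_int ((algebraMap ℤ_[3] ℚ_[3]).comp (Int.castRingHom ℤ_[3]))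
      ((algebraMap ℚ ℚ_[3]).comp (Int.castRingHom ℚ))]

/-- The image of `T + 1` (private plumbing). [folklore] -/
private theorem psi_X_add_one'' :
    (iwasawaToPowerSeries 3).comp (toIwasawa 3) (X + 1) = PowerSeries.X + 1 := by
  rw [← coe_map_map_eq'']
  simp

/-- The image of a constant (private plumbing). [folklore] -/
private theorem psi_C'' (c : ℤ) :
    (iwasawaToPowerSeries 3).comp (toIwasawa 3) (C c) = PowerSeries.C (c : ℚ_[3]) := by
  rw [← coe_map_map_eq'', Polynomial.map_C, Polynomial.map_C, Polynomial.coe_C, eq_intCast, eq_ratCast,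
    Rat.cast_intCast]

variable (b : ℤ)

/-- The entries of `A_n` read in `ℚ_3⟦T⟧` (private plumbing). [cite: Sprung2017, §3.1] -/
private theorem coe_map_halfLogApprox_eq'' (n : ℕ) (i k : Fin 2) :
    (((halfLogApprox 3 (3 * b) n i k).map (algebraMap ℚ ℚ_[3]) : ℚ_[3][X]) : PowerSeries ℚ_[3]) =
      (iwasawaToPowerSeries 3).comp (toIwasawa 3) (rowSeq (3 * b) 3 i (n + 1)) *
          PowerSeries.C ((((sprungCinv 3 (3 * b)) ^ (n + 2)) 0 k : ℚ) : ℚ_[3]) +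
        (iwasawaToPowerSeries 3).comp (toIwasawa 3) (rowSeq (3 * b) 3 i n) *
          PowerSeries.C ((((sprungCinv 3 (3 * b)) ^ (n + 2)) 1 k : ℚ) : ℚ_[3]) := by
  simp only [halfLogApprox, Polynomial.map_add, Polynomial.map_mul, Polynomial.map_C, Polynomial.coe_add,
    Polynomial.coe_mul, Polynomial.coe_C, coe_map_map_eq'', eq_ratCast]

/-- **`A_n = M_n·A_n(T^ι)`** with the refined twist matrix of `exists_twistMatrix_rowSeq_offDiag`.
[cite: Sprung2017, §3.4 Prop. 3.14 and §3.1] -/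
theorem exists_twistMatrix_halfLogApprox_offDiag (n : ℕ) :
    ∃ M : Matrix (Fin 2) (Fin 2) ℤ[X], ((C 3 : ℤ[X]) ∣ M 0 1 ∧ (C 3 : ℤ[X]) ∣ M 1 0 ∧
        (M 0 0).coeff 0 = 1 ∧ (M 1 1).coeff 0 = 1 ∧ (M 0 1).coeff 0 = 0 ∧ (M 1 0).coeff 0 = 0 ∧
        (M 0 1).coeff 1 = 2 * ∑ m ∈ Finset.range n,
          (sharpPoly (3 * b) 3 m).coeff 0 * (sharpPoly (3 * b) 3 (m + 1)).coeff 0) ∧ ∀ i k : Fin 2,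
      (((halfLogApprox 3 (3 * b) n i k).map (algebraMap ℚ ℚ_[3]) : ℚ_[3][X]) : PowerSeries ℚ_[3]) =
        iwasawaToPowerSeries 3 (toIwasawa 3 (M i 0)) *
            PowerSeries.subst (invOnePlusSubOne : PowerSeries ℚ_[3])
              (((halfLogApprox 3 (3 * b) n 0 k).map (algebraMap ℚ ℚ_[3]) : ℚ_[3][X]) : PowerSeries ℚ_[3]) +
          iwasawaToPowerSeries 3 (toIwasawa 3 (M i 1)) *
            PowerSeries.subst (invOnePlusSubOne : PowerSeries ℚ_[3])
              (((halfLogApprox 3 (3 * b) n 1 k).map (algebraMap ℚ ℚ_[3]) : ℚ_[3][X]) : PowerSeries ℚ_[3]) := by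
  have hι := hasSubst_invOnePlusSubOne (R := ℚ_[3])
  set ψ : ℤ[X] →+* PowerSeries ℚ_[3] := (iwasawaToPowerSeries 3).comp (toIwasawa 3) with hψ
  set σ : PowerSeries ℚ_[3] →+* PowerSeries ℚ_[3] := (PowerSeries.substAlgHom hι).toRingHom with hσ
  have hσapp : ∀ x : PowerSeries ℚ_[3], σ x = PowerSeries.subst (invOnePlusSubOne : PowerSeries ℚ_[3]) x :=
    fun x => by rw [hσ, AlgHom.toRingHom_eq_coe, RingHom.coe_coe, PowerSeries.coe_substAlgHom]
  have hC : σ (ψ (C (3 * b))) = ψ (C (3 * b)) := by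
    rw [hψ, psi_C'', PowerSeries.C_eq_algebraMap, hσ, AlgHom.toRingHom_eq_coe, RingHom.coe_coe, AlgHom.commutes]
  have hΦ : ∀ m : ℕ, ∃ w : PowerSeries ℚ_[3], σ (ψ ((cyclotomic (3 ^ (m + 1)) ℤ).comp (X + 1))) =
      w * ψ ((cyclotomic (3 ^ (m + 1)) ℤ).comp (X + 1)) ∧ ψ ((X + 1) ^ (2 * 3 ^ m)) * w = 1 := by
    intro m
    refine ⟨(invOnePlusSubOne + 1 : PowerSeries ℚ_[3]) ^ (2 * 3 ^ m), ?_, ?_⟩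
    · have hq : ψ ((cyclotomic (3 ^ (m + 1)) ℤ).comp (X + 1)) =
          (1 + PowerSeries.X : PowerSeries ℚ_[3]) ^ (2 * 3 ^ m) + (1 + PowerSeries.X) ^ 3 ^ m + 1 := by
        rw [cyclotomic_three_pow_succ_comp, map_add, map_add, map_pow, map_pow, map_one, hψ, psi_X_add_one'',
          add_comm PowerSeries.X 1]
      rw [hq, hσapp, subst_invOnePlusSubOne_cyclotomicFactor]
    · have hE : (1 + PowerSeries.X : PowerSeries ℚ_[3]) * (invOnePlusSubOne + 1) = 1 :=
        one_add_X_mul_invOnePlusSubOne_add_one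
      rw [map_pow, hψ, psi_X_add_one'', add_comm PowerSeries.X 1, ← mul_pow, hE, one_pow]
  obtain ⟨M, hinv, hM⟩ := exists_twistMatrix_rowSeq_offDiag ψ σ b hC hΦ n
  refine ⟨M, hinv, fun i k => ?_⟩
  have e1 := hM (n + 1) (Or.inl rfl) i
  have e0 := hM n (Or.inr rfl) i
  rw [coe_map_halfLogApprox_eq'', coe_map_halfLogApprox_eq'', coe_map_halfLogApprox_eq'', ← hψ, ← hσapp,
    ← hσapp]
  simp only [map_add, map_mul]
  have hc0 : σ (PowerSeries.C ((((sprungCinv 3 (3 * b)) ^ (n + 2)) 0 k : ℚ) : ℚ_[3])) =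
      PowerSeries.C ((((sprungCinv 3 (3 * b)) ^ (n + 2)) 0 k : ℚ) : ℚ_[3]) := by
    rw [PowerSeries.C_eq_algebraMap, hσ, AlgHom.toRingHom_eq_coe, RingHom.coe_coe, AlgHom.commutes]
  have hc1 : σ (PowerSeries.C ((((sprungCinv 3 (3 * b)) ^ (n + 2)) 1 k : ℚ) : ℚ_[3])) =
      PowerSeries.C ((((sprungCinv 3 (3 * b)) ^ (n + 2)) 1 k : ℚ) : ℚ_[3]) := by
    rw [PowerSeries.C_eq_algebraMap, hσ, AlgHom.toRingHom_eq_coe, RingHom.coe_coe, AlgHom.commutes]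
  rw [hc0, hc1]
  linear_combination (PowerSeries.C ((((sprungCinv 3 (3 * b)) ^ (n + 2)) 0 k : ℚ) : ℚ_[3])) * e1 +
    (PowerSeries.C ((((sprungCinv 3 (3 * b)) ^ (n + 2)) 1 k : ℚ) : ℚ_[3])) * e0

end Approximants

/-! ## §4 The limit with invariants -/

section Limit

/-- `[T^e] G(ι)` as a finite sum (private plumbing). [folklore] -/
private theorem coeff_subst_invOnePlusSubOne_eq_sum'' (G : PowerSeries ℚ_[3]) (e : ℕ) :
    PowerSeries.coeff e (PowerSeries.subst (invOnePlusSubOne : PowerSeries ℚ_[3]) G) =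
      ∑ d ∈ Finset.range (e + 1), PowerSeries.coeff d G *
        PowerSeries.coeff e ((invOnePlusSubOne : PowerSeries ℚ_[3]) ^ d) := by
  have h0 : PowerSeries.constantCoeff (invOnePlusSubOne : PowerSeries ℚ_[3]) = 0 := constantCoeff_invOnePlusSubOne
  rw [PowerSeries.coeff_subst' (PowerSeries.HasSubst.of_constantCoeff_zero' h0),
    finsum_eq_sum_of_support_subset _ (s := Finset.range (e + 1)) ?_]
  · simp only [smul_eq_mul]
  · intro d hd
    simp only [Function.mem_support, ne_eq, Finset.coe_range, Set.mem_Iio] at hd ⊢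
    by_contra hlt
    apply hd
    rw [PowerSeries.coeff_of_lt_order e (lt_of_lt_of_le (by exact_mod_cast (by omega : e < d))
      (natCast_le_order_pow h0 d)), smul_zero]

/-- The integers divisible by `3` form a closed subset of `ℤ_3` (private plumbing). [folklore] -/
private theorem isClosed_three_dvd' : IsClosed {x : ℤ_[3] | (3 : ℤ_[3]) ∣ x} := by
  have h : {x : ℤ_[3] | (3 : ℤ_[3]) ∣ x} = Metric.ball (0 : ℤ_[3]) 1 := by
    ext x
    rw [Set.mem_setOf_eq, mem_ball_zero_iff]
    have := PadicInt.norm_lt_one_iff_dvd x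
    exact_mod_cast this.symm
  rw [h]
  exact IsUltrametricDist.isClosed_ball 0 1

/-- The integers `≡ c (mod 9)` form a closed subset of `ℤ_3` (private plumbing). [folklore] -/
private theorem isClosed_nine_dvd_sub (c : ℤ_[3]) : IsClosed {x : ℤ_[3] | (9 : ℤ_[3]) ∣ x - c} := by
  have h : {x : ℤ_[3] | (9 : ℤ_[3]) ∣ x - c} = Metric.closedBall c (((3 : ℕ) : ℝ) ^ (-((2 : ℕ) : ℤ))) := by
    ext x
    rw [Set.mem_setOf_eq, Metric.mem_closedBall, dist_eq_norm,
      PadicInt.norm_le_pow_iff_mem_span_pow (x - c) 2, Ideal.mem_span_singleton]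
    norm_num
  rw [h]
  exact Metric.isClosed_closedBall

/-- **`ℒ(T) = M(T)·ℒ(T^ι)` with `M ∈ M₂(ℤ_3⟦T⟧)`, `M` diagonal mod `3`, `M ≡ 1 (mod T)` and `[T¹]M₀₁ ≡ 6b
(mod 9)`.** As `exists_integral_halfLogMatrix_eq_mul_subst_modThree`, with in addition `M₀₁(0) = M₁₀(0) = 0` and
`9 ∣ [T¹]M₀₁ − 6b`. [cite: Sprung2017, §3.4 Prop. 3.14, Cor. 4.4 and Cor. 4.6] [cite: GreenbergLNM1716, §1] -/
theorem exists_integral_halfLogMatrix_eq_mul_subst_offDiag (b : ℤ) :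
    ∃ M : Matrix (Fin 2) (Fin 2) (PowerSeries ℤ_[3]),
      (∀ j, (3 : ℤ_[3]) ∣ PowerSeries.coeff j (M 0 1)) ∧ (∀ j, (3 : ℤ_[3]) ∣ PowerSeries.coeff j (M 1 0)) ∧
      PowerSeries.constantCoeff (M 0 0) = 1 ∧ PowerSeries.constantCoeff (M 1 1) = 1 ∧
      PowerSeries.constantCoeff (M 0 1) = 0 ∧ PowerSeries.constantCoeff (M 1 0) = 0 ∧
      (9 : ℤ_[3]) ∣ PowerSeries.coeff 1 (M 0 1) - 6 * (b : ℤ_[3]) ∧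
      ∀ i k : Fin 2, halfLogMatrix b i k =
        iwasawaToPowerSeries 3 (M i 0) *
            PowerSeries.subst (invOnePlusSubOne : PowerSeries ℚ_[3]) (halfLogMatrix b 0 k) +
          iwasawaToPowerSeries 3 (M i 1) *
            PowerSeries.subst (invOnePlusSubOne : PowerSeries ℚ_[3]) (halfLogMatrix b 1 k) := by
  classical
  choose Mn hinv hMn using exists_twistMatrix_halfLogApprox_offDiag b
  let s : ℕ → (Fin 2 → Fin 2 → ℕ → ℤ_[3]) := fun n i l j => (((Mn n i l).coeff j : ℤ) : ℤ_[3])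
  obtain ⟨a, φ, hφ, ha⟩ := SeqCompactSpace.tendsto_subseq s
  have haZ : ∀ (i l : Fin 2) (j : ℕ), Tendsto (fun n => s (φ n) i l j) atTop (𝓝 (a i l j)) := fun i l j =>
    tendsto_pi_nhds.mp (tendsto_pi_nhds.mp (tendsto_pi_nhds.mp ha i) l) j
  have ha' : ∀ (i l : Fin 2) (j : ℕ),
      Tendsto (fun n => (((Mn (φ n) i l).coeff j : ℤ) : ℚ_[3])) atTop (𝓝 ((a i l j : ℤ_[3]) : ℚ_[3])) := by
    intro i l j
    have h4 := (continuous_subtype_val.tendsto (a i l j)).comp (haZ i l j)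
    refine h4.congr fun n => ?_
    simp [s, Function.comp]
  -- the invariants pass to the limit
  have hoff : ∀ (i l : Fin 2), (∀ n, (C 3 : ℤ[X]) ∣ Mn n i l) → ∀ j, (3 : ℤ_[3]) ∣ a i l j := by
    intro i l hn j
    have hmem : ∀ n, s (φ n) i l j ∈ {x : ℤ_[3] | (3 : ℤ_[3]) ∣ x} := by
      intro n
      obtain ⟨q, hq⟩ := hn (φ n)
      simp only [Set.mem_setOf_eq, s, hq, coeff_C_mul]
      push_cast
      exact Dvd.intro _ rfl
    exact isClosed_three_dvd'.mem_of_tendsto (haZ i l j) (Filter.Eventually.of_forall hmem)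
  have hconstlim : ∀ (i l : Fin 2) (c : ℤ), (∀ n, (Mn n i l).coeff 0 = c) → a i l 0 = c := by
    intro i l c hn
    have hconst : Tendsto (fun n => s (φ n) i l 0) atTop (𝓝 (c : ℤ_[3])) := by
      have : (fun n => s (φ n) i l 0) = fun _ => (c : ℤ_[3]) := by
        funext n
        simp [s, hn (φ n)]
      rw [this]
      exact tendsto_const_nhds
    exact tendsto_nhds_unique (haZ i l 0) hconst
  have hnine : (9 : ℤ_[3]) ∣ a 0 1 1 - 6 * (b : ℤ_[3]) := by
    have hmem : ∀ᶠ n in atTop, s (φ n) 0 1 1 ∈ {x : ℤ_[3] | (9 : ℤ_[3]) ∣ x - 6 * (b : ℤ_[3])} := by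
      refine Filter.eventually_atTop.2 ⟨2, fun n hn => ?_⟩
      have hφn : 2 ≤ φ n := le_trans hn hφ.le_apply
      obtain ⟨q, hq⟩ := nine_dvd_two_mul_sum_sub b (φ n) hφn
      rw [← (hinv (φ n)).2.2.2.2.2.2] at hq
      refine ⟨(q : ℤ_[3]), ?_⟩
      simp only [s]
      exact_mod_cast hq
    exact (isClosed_nine_dvd_sub _).mem_of_tendsto (haZ 0 1 1) hmem
  refine ⟨fun i l => PowerSeries.mk (a i l), ?_, ?_, ?_, ?_, ?_, ?_, ?_, fun i k => ?_⟩
  · intro j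
    rw [PowerSeries.coeff_mk]
    exact hoff 0 1 (fun n => (hinv n).1) j
  · intro j
    rw [PowerSeries.coeff_mk]
    exact hoff 1 0 (fun n => (hinv n).2.1) j
  · rw [← PowerSeries.coeff_zero_eq_constantCoeff_apply, PowerSeries.coeff_mk]
    exact_mod_cast hconstlim 0 0 1 (fun n => (hinv n).2.2.1)
  · rw [← PowerSeries.coeff_zero_eq_constantCoeff_apply, PowerSeries.coeff_mk]
    exact_mod_cast hconstlim 1 1 1 (fun n => (hinv n).2.2.2.1)
  · rw [← PowerSeries.coeff_zero_eq_constantCoeff_apply, PowerSeries.coeff_mk]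
    exact_mod_cast hconstlim 0 1 0 (fun n => (hinv n).2.2.2.2.1)
  · rw [← PowerSeries.coeff_zero_eq_constantCoeff_apply, PowerSeries.coeff_mk]
    exact_mod_cast hconstlim 1 0 0 (fun n => (hinv n).2.2.2.2.2.1)
  · rw [PowerSeries.coeff_mk]
    exact hnine
  ext j
  let T : (ℕ → ℚ_[3]) → (ℕ → ℚ_[3]) → ℚ_[3] := fun f g =>
    ∑ x ∈ Finset.HasAntidiagonal.antidiagonal j, f x.1 *
      ∑ d ∈ Finset.range (x.2 + 1), g d * PowerSeries.coeff x.2 ((invOnePlusSubOne : PowerSeries ℚ_[3]) ^ d)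
  have hT : ∀ F G : PowerSeries ℚ_[3],
      PowerSeries.coeff j (F * PowerSeries.subst (invOnePlusSubOne : PowerSeries ℚ_[3]) G) =
        T (fun d => PowerSeries.coeff d F) (fun d => PowerSeries.coeff d G) := by
    intro F G
    simp only [T, PowerSeries.coeff_mul, coeff_subst_invOnePlusSubOne_eq_sum'']
  have hTlim : ∀ {f g : ℕ → ℕ → ℚ_[3]} {f₀ g₀ : ℕ → ℚ_[3]},
      (∀ d, Tendsto (fun n => f n d) atTop (𝓝 (f₀ d))) → (∀ d, Tendsto (fun n => g n d) atTop (𝓝 (g₀ d))) →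
        Tendsto (fun n => T (f n) (g n)) atTop (𝓝 (T f₀ g₀)) := by
    intro f g f₀ g₀ hf hg
    exact tendsto_finsetSum _ fun x _ =>
      (hf x.1).mul (tendsto_finsetSum _ fun d _ => (hg d).mul_const _)
  have hcM : ∀ (n : ℕ) (i l : Fin 2) (d : ℕ),
      PowerSeries.coeff d (iwasawaToPowerSeries 3 (toIwasawa 3 (Mn n i l))) = (((Mn n i l).coeff d : ℤ) : ℚ_[3]) := by
    intro n i l d
    change PowerSeries.coeff d (PowerSeries.map (algebraMap ℤ_[3] ℚ_[3])
      ((((Mn n i l).map (Int.castRingHom ℤ_[3])) : ℤ_[3][X]) : PowerSeries ℤ_[3])) = _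
    rw [PowerSeries.coeff_map, Polynomial.coeff_coe, Polynomial.coeff_map]
    simp
  have hcMlim : ∀ (i l : Fin 2) (d : ℕ),
      PowerSeries.coeff d (iwasawaToPowerSeries 3 (PowerSeries.mk (a i l))) = ((a i l d : ℤ_[3]) : ℚ_[3]) := by
    intro i l d
    rw [PowerSeries.coeff_map, PowerSeries.coeff_mk]
    rfl
  have hlhs : Tendsto (fun n => coeffSeq b (φ n) i k j) atTop (𝓝 (PowerSeries.coeff j (halfLogMatrix b i k))) :=
    (tendsto_coeffSeq b i k j).comp hφ.tendsto_atTop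
  have heq : ∀ n : ℕ, coeffSeq b (φ n) i k j =
      T (fun d => (((Mn (φ n) i 0).coeff d : ℤ) : ℚ_[3])) (fun d => coeffSeq b (φ n) 0 k d) +
        T (fun d => (((Mn (φ n) i 1).coeff d : ℤ) : ℚ_[3])) (fun d => coeffSeq b (φ n) 1 k d) := by
    intro n
    have h := congrArg (PowerSeries.coeff j) (hMn (φ n) i k)
    rw [coeff_coe_map_halfLogApprox, map_add, hT, hT] at h
    simp only [hcM, coeff_coe_map_halfLogApprox] at h
    exact h
  have hrhs : Tendsto (fun n => coeffSeq b (φ n) i k j) atTop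
      (𝓝 (T (fun d => ((a i 0 d : ℤ_[3]) : ℚ_[3])) (fun d => PowerSeries.coeff d (halfLogMatrix b 0 k)) +
        T (fun d => ((a i 1 d : ℤ_[3]) : ℚ_[3])) (fun d => PowerSeries.coeff d (halfLogMatrix b 1 k)))) := by
    simp_rw [heq]
    exact (hTlim (ha' i 0) fun d => (tendsto_coeffSeq b 0 k d).comp hφ.tendsto_atTop).add
      (hTlim (ha' i 1) fun d => (tendsto_coeffSeq b 1 k d).comp hφ.tendsto_atTop)
  have hlim := tendsto_nhds_unique hlhs hrhs
  rw [hlim, map_add, hT, hT]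
  simp only [hcMlim]

end Limit

/-! ## §5 `M₀₁ = C(3)·T·u` with `u` a unit, for `3 ∤ b` -/

section Unit

/-- In `ℤ_3`: `(3 : ℤ_3) ∣ (k : ℤ)` iff `3 ∣ k` in `ℤ` (private plumbing). [folklore] -/
private theorem three_dvd_intCast_iff (k : ℤ) : (3 : ℤ_[3]) ∣ (k : ℤ_[3]) ↔ (3 : ℤ) ∣ k := by
  have h1 := PadicInt.norm_lt_one_iff_dvd (p := 3) (k : ℤ_[3])
  have h2 := PadicInt.norm_int_lt_one_iff_dvd (p := 3) k
  push_cast at h1 h2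
  exact h1.symm.trans h2

/-- In `ℤ_3`: an element not divisible by `3` is a unit (private plumbing). [folklore] -/
private theorem isUnit_of_not_three_dvd {x : ℤ_[3]} (hx : ¬ (3 : ℤ_[3]) ∣ x) : IsUnit x := by
  rw [PadicInt.isUnit_iff]
  have h1 := PadicInt.norm_lt_one_iff_dvd (p := 3) x
  push_cast at h1
  have hle := PadicInt.norm_le_one x
  by_contra hne
  exact hx (h1.mp (lt_of_le_of_ne hle hne))

/-- **`M₀₁ = 3·T·(unit)` (`3 ∤ b`).** For `a_3 = 3b` with `3 ∤ b` there is an integral transition matrix `M` of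
`ℒ = M·ℒ(T^ι)` with `M₀₁ = C(3)·T·u`, `u ∈ ℤ_3⟦T⟧ˣ`, every coefficient of `M₁₀` divisible by `3`, `M₁₀(0) = 0`,
`M₀₀(0) = M₁₁(0) = 1`. (At `b = ±1`, i.e. `a_3 = ±3`: `3u(0) ≡ 6b (mod 9)`.)
[cite: Sprung2017, §3.4 Prop. 3.14, Cor. 4.4 and Cor. 4.6] [cite: GreenbergLNM1716, §1] -/
theorem exists_integral_halfLogMatrix_offDiag_eq_C_mul_X_mul_unit (b : ℤ) (hb : ¬ (3 : ℤ) ∣ b) :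
    ∃ M : Matrix (Fin 2) (Fin 2) (PowerSeries ℤ_[3]),
      (∃ u : PowerSeries ℤ_[3], IsUnit u ∧ M 0 1 = PowerSeries.C (3 : ℤ_[3]) * PowerSeries.X * u) ∧
      (∀ j, (3 : ℤ_[3]) ∣ PowerSeries.coeff j (M 1 0)) ∧
      PowerSeries.constantCoeff (M 0 0) = 1 ∧ PowerSeries.constantCoeff (M 1 1) = 1 ∧
      PowerSeries.constantCoeff (M 1 0) = 0 ∧
      ∀ i k : Fin 2, halfLogMatrix b i k =
        iwasawaToPowerSeries 3 (M i 0) *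
            PowerSeries.subst (invOnePlusSubOne : PowerSeries ℚ_[3]) (halfLogMatrix b 0 k) +
          iwasawaToPowerSeries 3 (M i 1) *
            PowerSeries.subst (invOnePlusSubOne : PowerSeries ℚ_[3]) (halfLogMatrix b 1 k) := by
  obtain ⟨M, hM01, hM10, hM00, hM11, hM01z, hM10z, hM01o, hM⟩ :=
    exists_integral_halfLogMatrix_eq_mul_subst_offDiag b
  refine ⟨M, ?_, hM10, hM00, hM11, hM10z, hM⟩
  choose g hg using hM01
  -- `g 0 = 0`
  have hg0 : g 0 = 0 := by
    have h := hg 0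
    rw [PowerSeries.coeff_zero_eq_constantCoeff_apply, hM01z] at h
    rcases mul_eq_zero.mp h.symm with h3 | h0
    · exact absurd h3 (by norm_num)
    · exact h0
  -- `g 1` is a unit: `3·g 1 ≡ 6b (mod 9)`, `3 ∤ b`
  have hg1 : IsUnit (g 1) := by
    apply isUnit_of_not_three_dvd
    rintro ⟨t, ht⟩
    obtain ⟨q, hq⟩ := hM01o
    rw [hg 1, ht] at hq
    apply hb
    have h3 : ((2 * b : ℤ) : ℤ_[3]) * 3 = 3 * (t - q) * 3 := by
      push_cast
      linear_combination -hq
    have h2b : (3 : ℤ_[3]) ∣ ((2 * b : ℤ) : ℤ_[3]) := ⟨t - q, mul_right_cancel₀ (by norm_num : (3 : ℤ_[3]) ≠ 0) h3⟩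
    have h2b' := (three_dvd_intCast_iff (2 * b)).mp h2b
    have hcop : IsCoprime (3 : ℤ) 2 := ⟨1, -1, by norm_num⟩
    exact hcop.dvd_of_dvd_mul_left h2b'
  refine ⟨PowerSeries.mk fun j => g (j + 1), ?_, ?_⟩
  · rw [PowerSeries.isUnit_iff_constantCoeff, ← PowerSeries.coeff_zero_eq_constantCoeff_apply,
      PowerSeries.coeff_mk]
    exact hg1
  · ext j
    rw [mul_assoc, PowerSeries.coeff_C_mul, hg j]
    rcases j with _ | j
    · rw [PowerSeries.coeff_zero_X_mul, hg0, mul_zero]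
    · rw [PowerSeries.coeff_succ_X_mul, PowerSeries.coeff_mk]

end Unit

end Literature.NumberTheory.EllipticCurves.Sprung2017

end
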